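import Summits.CriticalPhenomena.Ising3DConformalLimit.Theorems.SubPtolemyInterlacingSubPtolemyFloorConditionalClosings
import Summits.CriticalPhenomena.Ising3DConformalLimit.Theorems.SubPtolemyInterlacingSubPtolemyFloorHybridCloses
import HarnessLib

/-!
# Birth skeleton (BC3) for crux `SubPtolemyFloor` — item stmt-CriticalPhenomena-15703,
# route `SubPtolemyInterlacing` (rank 3), sub-problem `Ising3DConformalLimit`

Crux BY NAME: `Summit.CriticalPhenomena.Ising3DConformalLimit.Theses.SubPtolemyInterlacing.SubPtolemyFloor`
`= ∃ a c : ℝ, a < log₂(1+√2) ∧ 0 < c ∧ ∀ n ≥ 1, c·n^{-a} ≤ ⟨σ₀σ_{n e₁}⟩_{β_c(3)}` — an all-`n` axial power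
floor for the critical nearest-neighbour Ising two-point function on `ℤ³` with exponent below the
Ptolemy-balanced Gaussian threshold `L = log₂(1+√2) = 1.27155…`, i.e. one-sided `η(3) < L - 1 = 0.2716`
(truth `2Δ_σ = 1.0363`, `η = 0.0363`).

## The cut (the route file's own TWO-LAYER PLAN: "SubPtolemyFloor ⇐ (η exists as a power) →
## (η < 0.2716 given existence) → SubPtolemyFloor"; lead a1's OPTION B)

* `stub_etaExists` — **EXISTENCE / REGULARITY**: the anomalous dimension `η(3)` exists in the tree's
  logarithmic sense, `log ⟨σ₀σ_x⟩_{β_c(3)} / log ‖x‖ → -(1 + η)` along `cofinite`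
  (`HasIsingExponentEta 3 η`). Open as a stand-alone theorem (Duminil-Copin ICM 2022 §4.2.1/§8.4), but
  INSIDE THE ROUTE it is delivered by the rank-4 crux `MoebiusLimit`: a non-degenerate scale-covariant
  pointwise limit makes `η = 2Δ - 1` exist (landed `SubPtolemyFloorHybrid.hasIsingExponentEta_of_scaleCovariant_limit`,
  p135087; re-derived below as the sorry-free dividend `etaExists_of_moebiusLimit`). Its tools are
  regularity tools (sub- and super-multiplicativity along the axis, Messager–Miracle-Solé monotonicity,
  Lamperti-type rigidity of renormalisations) — a different toolbox from the value bound.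
* `stub_etaBelowPtolemyThreshold` — **THE VALUE BOUND, CONDITIONAL FORM**: if `η(3)` exists then
  `η(3) < log₂(1+√2) - 1`. This is the exact shape of Duminil-Copin–Panis 2025, Theorem 1.5 (tree fact
  `dcp_isingEta_le_half_holds : ∀ η, HasIsingExponentEta 3 η → η ≤ 1/2`, PROVED in the tree from the
  reflected-gradient inequality Thm 1.2), with the constant to be pushed from `1/2` to below `0.2716`:
  the whole open content of the crux, constant-free, and implied by the crux
  (`SubPtolemyFloorHybrid.conditionalEta_of_subPtolemyFloor`). By the disprover's §3
  (`crux_iff_of_hasDecayExponent`) the crux GIVEN existence is exactly one inequality on the exponent, so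
  this cut loses nothing; by §5 (`not_floor_modelProfile`: the profile `n^{-3/2}` passes every two-point
  axiom the tree knows) the proof of THIS stub is where more-than-two-point / finite-range input must
  enter — honoured: nothing two-point-axiomatic is claimed for it.

Composition `SubPtolemyFloor_of` (closed form, crux by name from the two stubs; hypothesis form as a sorry-free
`example`) is a real proof: restrict the spatial exponent to the axis and run the landed bridge `SubPtolemyFloorPlusWall.subPtolemyFloor_of_hasIsingExponentEta` (p131889: eventually
`n^{-a} ≤ g(n)` for `1 + η < a < L`; the finitely many small `n` are absorbed into `c = g(N)` by MMS axial
monotonicity `criticalTwoPoint_axis_antitone`).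

## Disproof used (`Cruxes/SubPtolemyFloor/Disproof.lean`, cdisprove cycle 1; no `_false_without_` theorem,
## no `-- Targets` kill is recorded for this crux)
§1 `exponent_ge_one` / `floorAt_false_of_four_le`: `d = 3` is load-bearing — both stubs are stated at
`d = 3` only (`HasIsingExponentEta 3`), no dimension-uniform claim. §3 `crux_iff_of_hasDecayExponent`:
the cut existence/value is the sharp one. §4 threshold tightness: the strict `<` and the constant
`log₂(1+√2) - 1` are kept verbatim (no `≤`, no rounding). §5: see `stub_etaBelowPtolemyThreshold`.
Landed Negative lemmas (`Theorems/SubPtolemyFloor/Negative/{ExponentWindow, ExponentCharacterisation,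
ThresholdTight, TransferCostume}.lean`): neither stub is an instance they refute — TransferCostume
concerns the integrated / block / wall-cost currencies conjoined with doubling; the η-currency stub 2 is
strictly WEAKER than the crux (not the crux plus a hypothesis), and stub 1 is neither implied by nor
implies the crux.

## Dead lines avoided
`Sketch` (E = SusceptibilityFloor a₀ < 1.1661), `Sketch-plus-wall-quotient-ladder` (E = WallCost q < 0.6358),
`RouteNoteSketch-k1` (not a skeleton), `HybridCloses` (not a skeleton; its OPTION B is exactly this cut, whose
closing `conditionalEta_closes` is landed). This file does not transfer the crux into a new currency; it
registers the existence/value cut so that (i) stub 1 is visibly route-redundant under r4 and (ii) stub 2 is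
the one statement a future lower-bound ENGINE (beating DCP Thm 1.2 by a power) has to deliver.
-/

noncomputable section

namespace Summit.CriticalPhenomena.Ising3DConformalLimit.Cruxes.SubPtolemyFloor.Birth

open Literature.Probability.LatticeModels
open Summit.CriticalPhenomena.Ising3DConformalLimit.Theses
open Summit.CriticalPhenomena.Ising3DConformalLimit.Theses.SubPtolemyInterlacing

/-! ## The stubs -/

/-- **Stub 1 (existence of `η(3)`; size L as a theorem, FREE inside the route).** The critical
nearest-neighbour Ising two-point function on `ℤ³` has a logarithmic decay exponent:
`∃ η, log ⟨σ₀σ_x⟩_{β_c(3)} / log ‖x‖ → -(1 + η)` as `x → ∞`. Why plausibly true: universally expected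
(the scaling limit is believed conformal with `Δ_σ = 0.5181489(10)`); rigorous window for any such `η`:
`0 ≤ η ≤ 1/2` (infrared bound / Duminil-Copin–Panis 2025 Thm 1.5). Inside the route it follows from the
rank-4 crux `MoebiusLimit` (`etaExists_of_moebiusLimit` below, sorry-free). Leans on (for a stand-alone
proof): `messager_miracleSole_holds`, `HasDecayExponent.of_dyadic_of_antitone`, DCP Thm 1.3
`dcp_criticalTwoPoint_axis_lower_holds`. [cite: DuminilCopinICM2022, §4.2.1 and §8.4 (existence of η(3) open)] -/
theorem stub_etaExists : ∃ η : ℝ, HasIsingExponentEta 3 η := by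
  sorry

/-- **Stub 2 (the conditional value bound; the ENGINE; open problem).** If `η(3)` exists (logarithmic
sense) then `η(3) < log₂(1+√2) - 1 = 0.27155…`. Why plausibly true: `η = 0.0362978(20)` (conformal
bootstrap, Kos–Poland–Simmons-Duffin–Vichi 2016), `0.03627(10)` (MC) — a factor 7.5 of room; the tree's
registered conjecture S23 `CritIsing3DExponentValues` implies it (`subPtolemyFloor_of_critIsing3DExponentValues`
composed with `conditionalEta_of_subPtolemyFloor`). Rigorous frontier in exactly this shape:
`η ≤ 1/2` (Duminil-Copin–Panis 2025 Thm 1.5, tree `dcp_isingEta_le_half_holds`, from the reflected-gradient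
inequality Thm 1.2); the stub asks to beat it by `0.2285`. Why it might fail: only by `η(3) ≥ 0.2716`,
i.e. `Δ_σ ≥ 0.6358`, against all numerics (disprover §3: this is the unique kill). Leans on: nothing in
print suffices — needs a new lower-bound mechanism for critical correlations on `ℤ³` using finite-range,
more-than-two-point structure (disprover §5; false for RP long-range models with `α < 1.728`).
[cite: DuminilCopinPanis2025LowerBounds, Theorem 1.5 (arXiv:2404.05700 p. 6)] -/
theorem stub_etaBelowPtolemyThreshold :
    ∀ η : ℝ, HasIsingExponentEta 3 η → η < Real.logb 2 (1 + Real.sqrt 2) - 1 := by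
  sorry

/-! ## Composition: the stubs conclude the crux BY NAME (real proof; the only `sorry`s are inside the stubs) -/

/-- **The skeleton theorem** (closed form, the shape `ledger skeleton check` audits: conclusion = the crux
decl BY NAME, no hypotheses, every `sorry` inside a declared `stub_*`). Existence of `η(3)` (stub 1) and the
conditional bound `η(3) < log₂(1+√2) - 1` (stub 2) give the axial all-`n` floor: pick the `η` of stub 1,
bound it by stub 2, and apply the landed bridge `SubPtolemyFloorPlusWall.subPtolemyFloor_of_hasIsingExponentEta`
(p131889: restriction of the spatial exponent to the axis; eventual floor with exponent `a ∈ (1+η, log₂(1+√2))`;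
the finitely many small `n` absorbed into `c = g(N)` by Messager–Miracle-Solé axial monotonicity
`criticalTwoPoint_axis_antitone`). The hypothesis form `stub₁-sig → stub₂-sig → SubPtolemyFloor` is the
sorry-free `example` right below (an `example`, so that the audit sees exactly ONE theorem concluding the crux
by name). [cite: MessagerMiracleSoleJSP1977, main theorem (monotonicity of ⟨σ₀σ_x⟩ under reflections)] -/
theorem SubPtolemyFloor_of :
    Summit.CriticalPhenomena.Ising3DConformalLimit.Theses.SubPtolemyInterlacing.SubPtolemyFloor := by
  obtain ⟨η, hη⟩ := stub_etaExists
  exact SubPtolemyFloorPlusWall.subPtolemyFloor_of_hasIsingExponentEta η hη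
    (stub_etaBelowPtolemyThreshold η hη)

-- Hypothesis form of the composition, SORRY-FREE and independent of the stubs:
-- `(stub_etaExists-signature) → (stub_etaBelowPtolemyThreshold-signature) → SubPtolemyFloor`.
example :
    (∃ η : ℝ, HasIsingExponentEta 3 η) →
    (∀ η : ℝ, HasIsingExponentEta 3 η → η < Real.logb 2 (1 + Real.sqrt 2) - 1) →
      Summit.CriticalPhenomena.Ising3DConformalLimit.Theses.SubPtolemyInterlacing.SubPtolemyFloor := by
  rintro ⟨η, hη⟩ hbound
  exact SubPtolemyFloorPlusWall.subPtolemyFloor_of_hasIsingExponentEta η hη (hbound η hη)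

/-! ## Sorry-free dividends: where each stub sits relative to the route and to the crux -/

/-- **Stub 1 is route-redundant**: the route's rank-4 crux `MoebiusLimit` (a non-degenerate Möbius-, in
particular scale-covariant pointwise limit with dimension `Δ`) makes `η(3) = 2Δ - 1` exist
(landed `SubPtolemyFloorHybrid.hasIsingExponentEta_of_scaleCovariant_limit`). So, inside the deciding theorem
`closes`, the only open content of r3 beyond r4 is stub 2. [folklore] -/
theorem etaExists_of_moebiusLimit (hML : MoebiusLimit) : ∃ η : ℝ, HasIsingExponentEta 3 η := by
  obtain ⟨ρ, Δ, S, hρ, -, hlim, hnd, hmob⟩ := hML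
  exact ⟨2 * Δ - 1,
    SubPtolemyFloorHybrid.hasIsingExponentEta_of_scaleCovariant_limit hρ hlim hnd hmob.2.1⟩

/-- **Stub 2 is implied by the crux** (it is a genuine weakening, not the crux plus a hypothesis):
landed `SubPtolemyFloorHybrid.conditionalEta_of_subPtolemyFloor`. [folklore] -/
theorem etaBelowPtolemyThreshold_of_crux (h : SubPtolemyFloor) :
    ∀ η : ℝ, HasIsingExponentEta 3 η → η < Real.logb 2 (1 + Real.sqrt 2) - 1 :=
  SubPtolemyFloorHybrid.conditionalEta_of_subPtolemyFloor h

/-- **Rigorous frontier of stub 2, by name**: if `η(3)` exists then `η(3) ≤ 1/2`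
(Duminil-Copin–Panis 2025, Theorem 1.5, proved in the tree). The stub asks for `< 0.2716`.
[cite: DuminilCopinPanis2025LowerBounds, Theorem 1.5 (arXiv:2404.05700 p. 6)] -/
theorem eta_le_half_frontier : ∀ η : ℝ, HasIsingExponentEta 3 η → η ≤ 1 / 2 :=
  dcp_isingEta_le_half_holds

end Summit.CriticalPhenomena.Ising3DConformalLimit.Cruxes.SubPtolemyFloor.Birth

end
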